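import Mathlib.Algebra.BigOperators.Group.Finset.Powerset
import Summits.CriticalPhenomena.PercolationContinuityZ3.Theorems.PercNearOneGluingNoHeavyLowerTailKnQuestion8CoefficientwiseOffCluster
import HarnessLib

/-!
# Coefficientwise vdBHK conditional association for a PENDANT conditioning vertex (first rung of the coefficientwise programme, leaf case)

Support file (`--supports stmt-CriticalPhenomena-4575`, closed), prover `prim-lf-2` (gen 23).  No definitions, no named facts, no sorries; standard axioms.
Memo `prim-lf-2/CW-TLEMMA-gen23.md` (Corollary 3) and `prim-lf-2/CW-PROGRAMME-gen21.md` ((P4)).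

The first open rung of prim-lf-2's coefficientwise programme is CW-PA: for the uniform two-colouring `s / sᶜ` of the edges of a finite multigraph, with
`K = C_x(s)`, `K̄ = C_x(sᶜ)` and `S = {z ∉ K} ∩ {z ∉ K̄}` ('no monochromatic `x–z` path'),
  `Σ_{s ∈ S} f(K)·g(K) ≥ Σ_{s ∈ S} f(K)·g(K̄)`   for monotone `f, g`,
i.e. the count-one joint Bernstein coefficient of van den Berg–Häggström–Kahn's `E[fg | x ↮ z] ≥ E[f | x↮z]·E[g | x↮z]` is nonnegative on every minor
(DC-gen21 §2c).  This file proves it when `z` is PENDANT (exactly one edge `e₀ = {z,v}` at `z`): resolving the colour of `e₀` turns the sum into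
`2·Σ_{t ⊆ E∖e₀ : v ∉ C_x(t)} Δf·Δg` on `G − e₀`, which is `Coefficientwise.offCluster_twoColouring_nonneg` with the avoided set `{v}`.
* `Coefficientwise.offCluster_twoColouring_nonneg_sub` — the off-cluster theorem relative to an edge set `E'` (colourings of the sub-multigraph `E'`).
* `Coefficientwise.cwpa_pendant_symm` — `0 ≤ Σ_{s : z ∉ C_x(s), z ∉ C_x(sᶜ)} (f(C_x s) − f(C_x sᶜ))(g(C_x s) − g(C_x sᶜ))` for pendant `z`.
* `Coefficientwise.cwpa_pendant` — the printed form `Σ_{S} f(K) g(K̄) ≤ Σ_{S} f(K) g(K)`.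
[cite: KozmaNitzan2024, Questions 8–9 (§5.5 p. 36) (context: the Question-8 pocket covariance programme)]
-/

namespace Summit.CriticalPhenomena.PercolationContinuityZ3.Theorems

open Finset Literature.Probability.Percolation

namespace Coefficientwise

variable {ι V : Type*}

/-- Images of a configuration of the sub-multigraph `{i // i ∈ E'}` and of its push-forward agree. [cite: KozmaNitzan2024, §5.5 (context only)] -/
theorem image_map_subtype (ends : ι → Sym2 V) (E' : Finset ι) (t : Finset {i // i ∈ E'}) :
    (ends ∘ Subtype.val) '' (↑t : Set {i // i ∈ E'}) = ends '' (↑(t.map (Function.Embedding.subtype _)) : Set ι) := by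
  rw [Finset.coe_map, Set.image_image]
  rfl

/-- A walk from a vertex other than the leaf `z` that avoids the pendant edge never reaches `z`. [cite: KozmaNitzan2024, §5.5 (context only)] -/
theorem leaf_not_mem_openCluster (ends : ι → Sym2 V) {z x : V} {e₀ : ι} (hpend : ∀ i, z ∈ ends i → i = e₀) (hzx : z ≠ x)
    {t : Finset ι} (ht : e₀ ∉ t) : z ∉ openCluster (ends '' (↑t : Set ι)) x := by
  intro hz
  obtain ⟨p⟩ := hz
  have htr : ∀ u ∈ ({w | w ≠ z} : Set V), ∀ w, (openGraph (ends '' (↑t : Set ι))).Adj u w →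
      (openGraph (ends '' (↑t : Set ι))).Adj u w ∧ w ∈ ({w | w ≠ z} : Set V) := by
    intro u _ w hadj
    refine ⟨hadj, ?_⟩
    intro hwz
    rw [openGraph_image_adj] at hadj
    obtain ⟨⟨i, hit, hi⟩, _⟩ := hadj
    have : i = e₀ := hpend i (by rw [hi, Set.mem_setOf_eq.mp hwz]; exact Sym2.mem_mk_right u z)
    exact ht (this ▸ hit)
  exact ((reachable_transfer {w | w ≠ z} htr p) hzx.symm).2 rfl

variable [DecidableEq ι]

/-- Adding the pendant edge `e₀ = {z, v}` to a configuration whose red cluster of `x` misses `v` does not change that cluster.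
[cite: KozmaNitzan2024, §5.5 (context only)] -/
theorem openCluster_insert_pendant (ends : ι → Sym2 V) {z v x : V} {e₀ : ι} (he₀ : ends e₀ = s(z, v))
    (hpend : ∀ i, z ∈ ends i → i = e₀) (hzx : z ≠ x) {t : Finset ι} (ht : e₀ ∉ t)
    (hv : v ∉ openCluster (ends '' (↑t : Set ι)) x) :
    openCluster (ends '' (↑(insert e₀ t) : Set ι)) x = openCluster (ends '' (↑t : Set ι)) x := by
  refine Set.Subset.antisymm ?_ (openCluster_image_mono ends (Finset.subset_insert e₀ t) x)
  have hz : z ∉ openCluster (ends '' (↑t : Set ι)) x := leaf_not_mem_openCluster ends hpend hzx ht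
  have htr : ∀ u ∈ openCluster (ends '' (↑t : Set ι)) x, ∀ w, (openGraph (ends '' (↑(insert e₀ t) : Set ι))).Adj u w →
      (openGraph (ends '' (↑t : Set ι))).Adj u w ∧ w ∈ openCluster (ends '' (↑t : Set ι)) x := by
    intro u hu w hadj
    rw [openGraph_image_adj] at hadj
    obtain ⟨⟨i, hit, hi⟩, hne⟩ := hadj
    rcases Finset.mem_insert.mp hit with rfl | hit'
    · -- the edge is `e₀ = {z,v}`: then `u ∈ {z, v}`, impossible
      exfalso
      have hu' : u ∈ s(z, v) := by rw [← he₀, hi]; exact Sym2.mem_mk_left u w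
      rcases Sym2.mem_iff.mp hu' with rfl | rfl
      · exact hz hu
      · exact hv hu
    · have hadj' : (openGraph (ends '' (↑t : Set ι))).Adj u w := by
        rw [openGraph_image_adj]; exact ⟨⟨i, hit', hi⟩, hne⟩
      exact ⟨hadj', SimpleGraph.Reachable.trans hu hadj'.reachable⟩
  intro y hy
  obtain ⟨p⟩ := hy
  exact ((reachable_transfer _ htr p) (mem_openCluster_self _ x)).1

/-- With the pendant edge red, `z` joins the red cluster of `x` iff `v` is in the red cluster without the pendant edge.
[cite: KozmaNitzan2024, §5.5 (context only)] -/
theorem leaf_mem_openCluster_insert_iff (ends : ι → Sym2 V) {z v x : V} {e₀ : ι} (he₀ : ends e₀ = s(z, v))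
    (hpend : ∀ i, z ∈ ends i → i = e₀) (hzx : z ≠ x) (hzv : z ≠ v) {t : Finset ι} (ht : e₀ ∉ t) :
    z ∈ openCluster (ends '' (↑(insert e₀ t) : Set ι)) x ↔ v ∈ openCluster (ends '' (↑t : Set ι)) x := by
  constructor
  · intro hz
    by_contra hv
    rw [openCluster_insert_pendant ends he₀ hpend hzx ht hv] at hz
    exact leaf_not_mem_openCluster ends hpend hzx ht hz
  · intro hv
    have hv' : v ∈ openCluster (ends '' (↑(insert e₀ t) : Set ι)) x :=
      openCluster_image_mono ends (Finset.subset_insert e₀ t) x hv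
    have hadj : (openGraph (ends '' (↑(insert e₀ t) : Set ι))).Adj v z := by
      rw [openGraph_image_adj]
      exact ⟨⟨e₀, Finset.mem_insert_self e₀ t, by rw [he₀, Sym2.eq_swap]⟩, hzv.symm⟩
    exact SimpleGraph.Reachable.trans hv' hadj.reachable

open Classical in
/-- **Off-cluster two-colouring Harris on a sub-multigraph.**  For an edge set `E'`, a vertex `x`, a vertex set `A` and monotone `f, g`,
`0 ≤ Σ_{t ⊆ E' : A ∩ C_x(t) = ∅} (f(C_x t) − f(C_x(E' ∖ t)))·(g(C_x t) − g(C_x(E' ∖ t)))` — `offCluster_twoColouring_nonneg` for the multigraph with edge set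
`E'` (transported along `{i // i ∈ E'}`).  [cite: KozmaNitzan2024, Questions 8–9 (§5.5 p. 36) (context)] -/
theorem offCluster_twoColouring_nonneg_sub (ends : ι → Sym2 V) (E' : Finset ι) (x : V) (A : Set V) (f g : Set V → ℝ)
    (hf : Monotone f) (hg : Monotone g) :
    0 ≤ ∑ t ∈ E'.powerset.filter (fun t : Finset ι => ∀ a ∈ A, a ∉ openCluster (ends '' (↑t : Set ι)) x),
      (f (openCluster (ends '' (↑t : Set ι)) x) - f (openCluster (ends '' (↑(E' \ t) : Set ι)) x)) *
        (g (openCluster (ends '' (↑t : Set ι)) x) - g (openCluster (ends '' (↑(E' \ t) : Set ι)) x)) := by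
  set emb : {i // i ∈ E'} ↪ ι := Function.Embedding.subtype _ with hemb
  have key := offCluster_twoColouring_nonneg (ends ∘ Subtype.val : {i // i ∈ E'} → Sym2 V) x A f g hf hg
  -- complements correspond
  have map_compl : ∀ t : Finset {i // i ∈ E'}, (tᶜ).map emb = E' \ t.map emb := by
    intro t
    ext i
    simp only [Finset.mem_map, Finset.mem_compl, Finset.mem_sdiff, hemb, Function.Embedding.coe_subtype]
    constructor
    · rintro ⟨⟨j, hj⟩, hjt, rfl⟩
      exact ⟨hj, fun ⟨⟨k, hk⟩, hkt, hkj⟩ => hjt (by cases hkj; exact hkt)⟩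
    · rintro ⟨hiE, hnot⟩
      exact ⟨⟨i, hiE⟩, fun hit => hnot ⟨⟨i, hiE⟩, hit, rfl⟩, rfl⟩
  have map_sub : ∀ t : Finset {i // i ∈ E'}, t.map emb ⊆ E' := by
    intro t i hi
    obtain ⟨⟨j, hj⟩, _, rfl⟩ := Finset.mem_map.mp hi
    exact hj
  refine key.trans_eq ?_
  refine Finset.sum_bij' (fun t _ => t.map emb) (fun t _ => t.subtype (· ∈ E')) ?_ ?_ ?_ ?_ ?_
  · intro t ht
    rw [Finset.mem_filter] at ht ⊢
    refine ⟨Finset.mem_powerset.mpr (map_sub t), ?_⟩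
    rw [← image_map_subtype]; exact ht.2
  · intro t ht
    rw [Finset.mem_filter] at ht ⊢
    refine ⟨Finset.mem_univ _, ?_⟩
    have hsub : t ⊆ E' := Finset.mem_powerset.mp ht.1
    rw [image_map_subtype, Finset.subtype_map_of_mem (fun i hi => hsub hi)]
    exact ht.2
  · intro t _
    ext ⟨i, hi⟩
    rw [Finset.mem_subtype, Finset.mem_map]
    constructor
    · rintro ⟨⟨j, hj⟩, hjt, hji⟩
      have hji' : j = i := by simpa [hemb] using hji
      subst hji'
      exact hjt
    · intro h
      exact ⟨⟨i, hi⟩, h, by simp [hemb]⟩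
  · intro t ht
    have hsub : t ⊆ E' := Finset.mem_powerset.mp (Finset.mem_filter.mp ht).1
    exact Finset.subtype_map_of_mem (fun i hi => hsub hi)
  · intro t _
    rw [image_map_subtype, image_map_subtype ends E' (tᶜ), map_compl]

variable [Fintype ι]

open Classical in
/-- **Coefficientwise vdBHK-PA for a pendant conditioning vertex (symmetrised form).**  If `z ≠ x` is a leaf of the multigraph (`e₀ = {z, v}` its
only edge, `z ≠ v`), then for monotone `f, g`,
  `0 ≤ Σ_{s : z ∉ C_x(s), z ∉ C_x(sᶜ)} (f(C_x s) − f(C_x sᶜ))·(g(C_x s) − g(C_x sᶜ))`.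
Proof: resolve the colour of `e₀`; either way the constraint becomes 'v ∉ C_x' in the colour of `e₀` on `G − e₀`, and the two halves are equal by the
colour swap, giving `2 · Σ_{t ⊆ E∖e₀ : v ∉ C_x(t)} Δf·Δg ≥ 0` (`offCluster_twoColouring_nonneg_sub` with `A = {v}`).  (prim-lf-2 CW-TLEMMA-gen23, Cor. 3.)
[cite: KozmaNitzan2024, Questions 8–9 (§5.5 p. 36) (context)] -/
theorem cwpa_pendant_symm (ends : ι → Sym2 V) {z v x : V} {e₀ : ι} (he₀ : ends e₀ = s(z, v))
    (hpend : ∀ i, z ∈ ends i → i = e₀) (hzx : z ≠ x) (hzv : z ≠ v) (f g : Set V → ℝ) (hf : Monotone f) (hg : Monotone g) :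
    0 ≤ ∑ s ∈ univ.filter (fun s : Finset ι => z ∉ openCluster (ends '' (↑s : Set ι)) x ∧ z ∉ openCluster (ends '' (↑(sᶜ) : Set ι)) x),
      (f (openCluster (ends '' (↑s : Set ι)) x) - f (openCluster (ends '' (↑(sᶜ) : Set ι)) x)) *
        (g (openCluster (ends '' (↑s : Set ι)) x) - g (openCluster (ends '' (↑(sᶜ) : Set ι)) x)) := by
  set K : Finset ι → Set V := fun s => openCluster (ends '' (↑s : Set ι)) x with hK
  set E' : Finset ι := univ.erase e₀ with hE'
  set Φ' : Finset ι → ℝ := fun t => (f (K t) - f (K (E' \ t))) * (g (K t) - g (K (E' \ t))) with hΦ'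
  change 0 ≤ ∑ s ∈ univ.filter (fun s : Finset ι => z ∉ K s ∧ z ∉ K sᶜ), (f (K s) - f (K sᶜ)) * (g (K s) - g (K sᶜ))
  have he₀E' : e₀ ∉ E' := fun h => (Finset.mem_erase.mp h).1 rfl
  have huniv : (univ : Finset (Finset ι)) = (insert e₀ E').powerset := by
    rw [hE', Finset.insert_erase (Finset.mem_univ e₀), Finset.powerset_univ]
  -- the half-sum on `G − e₀`
  have hbase : 0 ≤ ∑ t ∈ E'.powerset.filter (fun t : Finset ι => v ∉ K t), Φ' t := by
    have := offCluster_twoColouring_nonneg_sub ends E' x ({v} : Set V) f g hf hg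
    simpa [hK, hΦ'] using this
  -- complements inside `E'`
  have compl_of_sub : ∀ t, t ⊆ E' → tᶜ = insert e₀ (E' \ t) := by
    intro t ht
    ext i
    simp only [Finset.mem_compl, Finset.mem_insert, Finset.mem_sdiff, hE', Finset.mem_erase, Finset.mem_univ, and_true]
    constructor
    · intro hi
      by_cases hie : i = e₀
      · exact Or.inl hie
      · exact Or.inr ⟨hie, hi⟩
    · rintro (rfl | ⟨_, hi⟩)
      · exact fun h => he₀E' (ht h)
      · exact hi
  have compl_insert_of_sub : ∀ t, t ⊆ E' → (insert e₀ t)ᶜ = E' \ t := by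
    intro t ht
    ext i
    simp only [Finset.mem_compl, Finset.mem_insert, Finset.mem_sdiff, hE', Finset.mem_erase, Finset.mem_univ, and_true, not_or]
  have notin_of_sub : ∀ t, t ⊆ E' → e₀ ∉ t := fun t ht h => he₀E' (ht h)
  have notin_sdiff : ∀ t, e₀ ∉ E' \ t := fun t h => he₀E' (Finset.mem_sdiff.mp h).1
  -- rewrite the filtered sum as an `ite`-sum over all colourings and split along `e₀`
  rw [Finset.sum_filter, huniv, Finset.sum_powerset_insert he₀E']
  -- identify the two halves
  have h1 : ∑ t ∈ E'.powerset, (if z ∉ K t ∧ z ∉ K tᶜ then (f (K t) - f (K tᶜ)) * (g (K t) - g (K tᶜ)) else 0) =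
      ∑ t ∈ E'.powerset, (if v ∉ K (E' \ t) then Φ' t else 0) := by
    refine Finset.sum_congr rfl fun t ht => ?_
    have hsub : t ⊆ E' := Finset.mem_powerset.mp ht
    have hzt : z ∉ K t := leaf_not_mem_openCluster ends hpend hzx (notin_of_sub t hsub)
    rw [compl_of_sub t hsub]
    by_cases hv : v ∈ K (E' \ t)
    · have hz : z ∈ K (insert e₀ (E' \ t)) := (leaf_mem_openCluster_insert_iff ends he₀ hpend hzx hzv (notin_sdiff t)).mpr hv
      simp [hz, hv]
    · have hKc : K (insert e₀ (E' \ t)) = K (E' \ t) := openCluster_insert_pendant ends he₀ hpend hzx (notin_sdiff t) hv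
      have hzc : z ∉ K (E' \ t) := leaf_not_mem_openCluster ends hpend hzx (notin_sdiff t)
      rw [hKc]
      simp [hzt, hzc, hv, hΦ']
  have h2 : ∑ t ∈ E'.powerset, (if z ∉ K (insert e₀ t) ∧ z ∉ K (insert e₀ t)ᶜ then
        (f (K (insert e₀ t)) - f (K (insert e₀ t)ᶜ)) * (g (K (insert e₀ t)) - g (K (insert e₀ t)ᶜ)) else 0) =
      ∑ t ∈ E'.powerset, (if v ∉ K t then Φ' t else 0) := by
    refine Finset.sum_congr rfl fun t ht => ?_
    have hsub : t ⊆ E' := Finset.mem_powerset.mp ht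
    rw [compl_insert_of_sub t hsub]
    have hzc : z ∉ K (E' \ t) := leaf_not_mem_openCluster ends hpend hzx (notin_sdiff t)
    by_cases hv : v ∈ K t
    · have hz : z ∈ K (insert e₀ t) := (leaf_mem_openCluster_insert_iff ends he₀ hpend hzx hzv (notin_of_sub t hsub)).mpr hv
      simp [hz, hv]
    · have hKi : K (insert e₀ t) = K t := openCluster_insert_pendant ends he₀ hpend hzx (notin_of_sub t hsub) hv
      have hzt : z ∉ K t := leaf_not_mem_openCluster ends hpend hzx (notin_of_sub t hsub)
      rw [hKi]
      simp [hzt, hzc, hv, hΦ']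
  -- the first half equals the second by the colour swap inside `E'`
  have h3 : ∑ t ∈ E'.powerset, (if v ∉ K (E' \ t) then Φ' t else 0) = ∑ t ∈ E'.powerset, (if v ∉ K t then Φ' t else 0) := by
    refine Finset.sum_bij' (fun t _ => E' \ t) (fun t _ => E' \ t) ?_ ?_ ?_ ?_ ?_
    · intro t _; exact Finset.mem_powerset.mpr Finset.sdiff_subset
    · intro t _; exact Finset.mem_powerset.mpr Finset.sdiff_subset
    · intro t ht; exact Finset.sdiff_sdiff_eq_self (Finset.mem_powerset.mp ht)
    · intro t ht; exact Finset.sdiff_sdiff_eq_self (Finset.mem_powerset.mp ht)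
    · intro t ht
      have hsub : t ⊆ E' := Finset.mem_powerset.mp ht
      have hΦsym : Φ' (E' \ t) = Φ' t := by
        simp only [hΦ', Finset.sdiff_sdiff_eq_self hsub]; ring
      rw [hΦsym]
  rw [h1, h2, h3, ← Finset.sum_filter]
  linarith [hbase]

open Classical in
/-- **Coefficientwise vdBHK-PA for a pendant conditioning vertex (printed form, DC-gen21 §2c).**  For a leaf `z ≠ x` (`e₀ = {z,v}` its only edge) and
monotone `f, g`, with `S = {z ∉ C_x(s)} ∩ {z ∉ C_x(sᶜ)}` ('no monochromatic `x–z` path'),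
  `Σ_{s ∈ S} f(C_x s)·g(C_x sᶜ) ≤ Σ_{s ∈ S} f(C_x s)·g(C_x s)`,
i.e. given `S`, 'both properties in the red cluster' beats 'one in red, one in blue' — the count-one joint Bernstein coefficient of vdBHK's conditional positive
association is `≥ 0` on every minor in which `z` is pendant.  (Swap symmetry `s ↦ sᶜ` + `cwpa_pendant_symm`.)
[cite: KozmaNitzan2024, Questions 8–9 (§5.5 p. 36) (context)] -/
theorem cwpa_pendant (ends : ι → Sym2 V) {z v x : V} {e₀ : ι} (he₀ : ends e₀ = s(z, v))
    (hpend : ∀ i, z ∈ ends i → i = e₀) (hzx : z ≠ x) (hzv : z ≠ v) (f g : Set V → ℝ) (hf : Monotone f) (hg : Monotone g) :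
    ∑ s ∈ univ.filter (fun s : Finset ι => z ∉ openCluster (ends '' (↑s : Set ι)) x ∧ z ∉ openCluster (ends '' (↑(sᶜ) : Set ι)) x),
        f (openCluster (ends '' (↑s : Set ι)) x) * g (openCluster (ends '' (↑(sᶜ) : Set ι)) x) ≤
      ∑ s ∈ univ.filter (fun s : Finset ι => z ∉ openCluster (ends '' (↑s : Set ι)) x ∧ z ∉ openCluster (ends '' (↑(sᶜ) : Set ι)) x),
        f (openCluster (ends '' (↑s : Set ι)) x) * g (openCluster (ends '' (↑s : Set ι)) x) := by
  set K : Finset ι → Set V := fun s => openCluster (ends '' (↑s : Set ι)) x with hK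
  set D : Finset (Finset ι) := univ.filter (fun s : Finset ι => z ∉ K s ∧ z ∉ K sᶜ) with hD
  change ∑ s ∈ D, f (K s) * g (K sᶜ) ≤ ∑ s ∈ D, f (K s) * g (K s)
  have hsymm := cwpa_pendant_symm ends he₀ hpend hzx hzv f g hf hg
  change 0 ≤ ∑ s ∈ D, (f (K s) - f (K sᶜ)) * (g (K s) - g (K sᶜ)) at hsymm
  -- reindex by the swap `s ↦ sᶜ` (which preserves `D`)
  have memD : ∀ s, s ∈ D ↔ (z ∉ K s ∧ z ∉ K sᶜ) := fun s => by simp [hD]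
  have swap : ∀ h : Finset ι → ℝ, ∑ s ∈ D, h sᶜ = ∑ s ∈ D, h s := by
    intro h
    refine Finset.sum_bij' (fun s _ => sᶜ) (fun s _ => sᶜ) ?_ ?_ ?_ ?_ ?_
    · intro s hs; rw [memD] at hs ⊢; rw [compl_compl]; exact ⟨hs.2, hs.1⟩
    · intro s hs; rw [memD] at hs ⊢; rw [compl_compl]; exact ⟨hs.2, hs.1⟩
    · intro s _; exact compl_compl s
    · intro s _; exact compl_compl s
    · intro s _; rfl
  have e1 : ∑ s ∈ D, f (K sᶜ) * g (K sᶜ) = ∑ s ∈ D, f (K s) * g (K s) := swap (fun s => f (K s) * g (K s))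
  have e2 : ∑ s ∈ D, f (K sᶜ) * g (K s) = ∑ s ∈ D, f (K s) * g (K sᶜ) := by
    have := swap (fun s => f (K s) * g (K sᶜ))
    simpa only [compl_compl] using this
  have hexp : ∑ s ∈ D, (f (K s) - f (K sᶜ)) * (g (K s) - g (K sᶜ)) =
      2 * ∑ s ∈ D, f (K s) * g (K s) - 2 * ∑ s ∈ D, f (K s) * g (K sᶜ) := by
    have : ∀ s, (f (K s) - f (K sᶜ)) * (g (K s) - g (K sᶜ)) =
        f (K s) * g (K s) + f (K sᶜ) * g (K sᶜ) - f (K s) * g (K sᶜ) - f (K sᶜ) * g (K s) := fun s => by ring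
    simp only [this, Finset.sum_sub_distrib, Finset.sum_add_distrib, e1, e2]
    ring
  rw [hexp] at hsymm
  linarith

end Coefficientwise

end Summit.CriticalPhenomena.PercolationContinuityZ3.Theorems
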